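import Summits.HodgeConjecture.HodgeConjecture.Theorems.F0P3LettersTraceFactorisationS0     -- ★ p824116 TF ED. 2 (guarded `∃ S₀`): `TraceFactorisation` — the TARGET letter (row #84); cone: ★ PH `IsProductHaar`, ★ K0 tokens, ★ «RC»
import Summits.HodgeConjecture.HodgeConjecture.Theorems.F0P3TracePureTensorOfArchSplit        -- ★ p836501 J1b (F0P3-p01 (g11), ROAD «TF»): `stub_trace_pureTensor_of_archFinTraceSplit` — (A) FROM the letter `ArchFinTraceSplit` (J1a ★ p836307)
import Summits.HodgeConjecture.HodgeConjecture.Theorems.F0P3TraceFactorisationSphericalLine    -- ★ p826025 (F0P3-p03 (g7)): (B) head `stub_sphericalLine_eigen_closed`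
import Summits.HodgeConjecture.HodgeConjecture.Theorems.F0P3TraceFactorisationZeroBranch       -- ★ p825982 (A-p17 (g17)): (C) head `smoothTrace_clFinChoice_eq_zero_offS0`
import Summits.HodgeConjecture.HodgeConjecture.Theorems.F0P3TraceFactorisationKcIdempotent      -- ★ p826033 (A-p01 (g17)): (D) head `trGp₀_tens₀_eq_zero_of_not_cptTriv₀`
import HarnessLib

/-!
# `F0P3TraceFactorisationOfStubs` — the SORRY-FREE Theorems twin of the pay-down line `Cruxes/H413/Lines/F0_P3_TraceFactorisationPaydown.lean`:
# the letter TF (#84) ★ `F0P3LettersTraceFactorisationS0.TraceFactorisation` FROM the ONE residual letter `ArchFinTraceSplit` (J1a), everything else ★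

Cell `hodgecm-mathlib`, F0∕P3 «U3-mult», crux H413 (`stmt-HodgeConjecture-24833`); seat F0P3-p04 (g9) (the «K9β» closer lineage), BID 23:2xZ on the F0∕P3 bus.
THEOREMS ONLY: no `def`, no instance, no notation, no `sorry`, no named fact.  PURPOSE — the closer-junction prerequisite for the registered stub `stub_TF` of
`Cruxes/H413/Lines/F0_U3LettersRung1.lean` («K9β», ED. 13∕14), exactly as ★ `F0P3bXiLocalPacketUnitaryOfStubs` (XLPU), ★ `F0P3KeysCaseTwoOfStubs` (Keys) and
★ `F0P3CohClassRoutingCotOfS2Sharp` (L3) were: by (V60)∕R-33 the closer never imports a Lines head whose `--axioms` carry `sorryAx` (the TF line's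
`traceFactorisation_closed` does, through its stub (A)), so the junction needs a Theorems module with TRIO axioms that takes the residual LETTER as a hypothesis.  With
this file the closer's next edition can write, BY NAME,
`theorem stub_TF : StubTF := F0P3TraceFactorisationOfStubs.stubTF_of_archFinTraceSplit stub_AFS` over a NEW registered print stub
`stub_AFS : ∀ ‹StubTF's frame›, F0P3LettersArchFinTraceSplit.ArchFinTraceSplit L H ι T hT μ ν νinf μv` (#84 re-denominated to the archimedean ∕ Hilbert half — ROAD «TF» lead
memo `F0/P3a/F0P3a-p07/g5/ROAD-TF-HANDOFF.F0P3a-p07g5.md` §2, count-neutral).  HONEST LABEL: HC_CM is proved only modulo the printed citations until rung 0 closes; this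
file discharges no letter — it moves the open content of #84 from «(A) the trace of a pure tensor factorises» to the letter `ArchFinTraceSplit` {admissibility [HarishChandra1953
Thms 4–6], the type-I ∕ Flath split `π′ ≅ π′_∞ ⊗ π′_f` [FlathCorvallis1979 Thm. 3–4; BorelJacquet1979 §4.6], HC Thm 8 hard half, trace class [Knapp1986 Thm. 10.2]}.

THE ROAD «TF» (F0P3-plan (g7) 21:38:24Z; lead F0P3a-p07 (g5), hands F0P3-p01 (g11) ⊗′ core, F0P3-p03 (g8) measure∕transport; 13 ★ bricks, all `--supports 24833`):
the finite Flath product (★ P1–P4, P4c, P5a∕b), the token match `σ_v = clFinChoice (rep c) v` (★ `F0P3FlathLocalTypeToken`), the `ramCls₀` dictionary and the Gelfand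
zero branch are PAID in-house; J1a ★ p836307 states the residual letter `ArchFinTraceSplit`; J1b ★ p836501 `stub_trace_pureTensor_of_archFinTraceSplit` proves the TF line's
stub (A) VERBATIM from it.  The line's other three stubs are ★ since its ED. 2: (B) p826025, (C) p825982, (D) p826033.

Contents (all proved; axioms TRIO):
* `traceFactorisation_of_four` — the TF line's kernel-checked composition `traceFactorisation_of_stubs` VERBATIM (Lines → Theorems copy; the four stub TEXTS (A)(B)(C)(D) as
  hypotheses `hA hB hC hD`): `S₀ := S₀ᴬ ∪ S₀ᶜ`; main branch = (A).1 + ★ `chS₀_def` + (B); zero branch = (D) if `Kc` acts non-trivially, else (C) at a ramified explicit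
  place in `fT.T`, else (A).2.
* `traceFactorisation_of_archFinTraceSplit (hAFS : ArchFinTraceSplit L H ι T hT μ ν νinf μv) : TraceFactorisation L H ι T hT μ ν νinf μv` — J1b at `hA`, ★ (B)(C)(D) at
  `hB hC hD`.
* `stubTF_of_archFinTraceSplit` — the CLOSED form over the letters' frame: `(∀ ‹frame›, ArchFinTraceSplit …) → ∀ ‹frame›, TraceFactorisation …`, hypothesis and conclusion
  spelled with EXACTLY the binder list of the closer's `StubTF` (§C.6 of `Lines/F0_U3LettersRung1.lean`) ∕ the TF line's `TraceFactorisationClosed` ((V47) telescope) — the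
  ∀-closure of the letter is INLINED (no `def`), as ★ p835782 `F0T1bSemilocalCharactersLinIndepOfStubs` did for (L2-SA).

## References
* [FlathCorvallis1979] D. Flath, *Decomposition of representations into tensor products*, Proc. Sympos. Pure Math. 33.1 (1979), Thm. 3 and Thm. 4.
* [Rogawski1990] J. D. Rogawski, *Automorphic Representations of Unitary Groups in Three Variables*, Ann. of Math. Stud. 123 (1990): §13.7 p. 206; §14.5 p. 237; §14.6 pp. 236, 241, 244.
* [CartierCorvallis1979] P. Cartier, *Representations of 𝔭-adic groups: a survey*, Proc. Sympos. Pure Math. 33.1 (1979), §IV.1 Cor. 4.1.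
* [BorelJacquet1979] A. Borel, H. Jacquet, *Automorphic forms and automorphic representations*, Proc. Sympos. Pure Math. 33.1 (1979), §4.1, §4.6.
* [GetzHahn2024] J. Getz, H. Hahn, *An Introduction to Automorphic Representations*, GTM 300 (2024): Thm. 6.5.2 p. 121; Cor. 5.5.2 p. 106; §8.5 (8.15) p. 159.
* [Knapp1986] A. Knapp, *Representation Theory of Semisimple Groups*, Princeton (1986), Thm. 10.2.
-/

set_option autoImplicit false
set_option linter.dupNamespace false

noncomputable section

open NumberField IsDedekindDomain MeasureTheory
open Literature.NumberTheory.Rogawski1990 Literature.NumberTheory.GaloisRepresentations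
open Literature.NumberTheory.Automorphic Literature.NumberTheory.Automorphic.UnitaryGroup
open Literature.NumberTheory.Automorphic.UnitaryGroup.CotangentForms
open scoped Matrix

namespace Summit.HodgeConjecture.HodgeConjecture.Cruxes.H413.F0P3TraceFactorisationOfStubs

open Summit.HodgeConjecture.HodgeConjecture.Cruxes.H413.F0P3InnerFormClassificationV6
open Summit.HodgeConjecture.HodgeConjecture.Cruxes.H413.F0P3ClassTokensOfRecord (Cls cl rep mult)
open Summit.HodgeConjecture.HodgeConjecture.Cruxes.H413.F0P3ClassTokenChoice (clFinChoice evpChoice evpChoice_of_not)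
open Summit.HodgeConjecture.HodgeConjecture.Cruxes.H413.F0P3CompactTrivOfRecord (cptTriv₀)
open Summit.HodgeConjecture.HodgeConjecture.Cruxes.H413.F0P3UnitaryLocOfRecord (clInfChoiceU)
open Summit.HodgeConjecture.HodgeConjecture.Cruxes.H413.F0P3TestFunctionsOfRecord (Unr₀ hat₀ hat₀_germ)
open Summit.HodgeConjecture.HodgeConjecture.Cruxes.H413.F0P3SpectralSideOfRecord (trGp₀)
open Summit.HodgeConjecture.HodgeConjecture.Cruxes.H413.F0P3SemilocalTestFunctionsOfRecord (TestS₀ tens₀ chS₀ chS₀_def)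
open Summit.HodgeConjecture.HodgeConjecture.Cruxes.H413.F0P3bArchDegOneClass (archDegOneClass)
open Summit.HodgeConjecture.HodgeConjecture.Cruxes.H413.F0P3RamClsOfRecord (ramCls₀)
open Summit.HodgeConjecture.HodgeConjecture.Cruxes.H413.F0P3LettersTraceFactorisation (IsProductHaar)
open Summit.HodgeConjecture.HodgeConjecture.Cruxes.H413.F0P3LettersTraceFactorisationS0 (TraceFactorisation)
open Summit.HodgeConjecture.HodgeConjecture.Cruxes.H413.F0P3LettersArchFinTraceSplit (ArchFinTraceSplit)

section Frame

variable (L : Type) [Field L] [NumberField L] [IsCMField L] (H : Matrix (Fin 3) (Fin 3) L) (ι : L →+* ℂ) (T : GL (Fin 3) ℂ)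
  (hT : (T : Matrix (Fin 3) (Fin 3) ℂ)ᴴ * H.map ι * (T : Matrix (Fin 3) (Fin 3) ℂ) = Literature.Geometry.ComplexHyperbolic.BallModel.J)
  (μ : Measure (Gp L H).automorphicQuotient) [(Gp L H).IsAutomorphicMeasure μ]
  [MeasurableSpace (Gp L H).Adelic] [BorelSpace (Gp L H).Adelic]
  (ν : Measure (Gp L H).Adelic) [IsFiniteMeasureOnCompacts ν]
  (νinf : @Measure (UnitaryGroup.arch (↥(maximalRealSubfield L)) L (IsCMField.complexConj L) 3 H) (borel _))
  (μv : ∀ v : Places L, @Measure ((cmDatum L 3 H).Local v) (borel _))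

/-- **`TraceFactorisation` FROM THE FOUR STUB TEXTS** — the TF line's kernel-checked composition `traceFactorisation_of_stubs` (ED. 2, tree a7be43c0df9dc9d9 :165–:219),
VERBATIM, with the texts of (A) `stub_trace_pureTensor`, (B) `stub_sphericalLine_eigen`, (C) `stub_zeroBranch_offS0`, (D) `stub_KcIdempotent` as hypotheses: `S₀ := S₀ᴬ ∪ S₀ᶜ`;
the main branch is (A).1 rewritten by ★ `chS₀_def` and (B); the zero branch is (D) when `Kc` acts non-trivially, else — some `v ∈ ramCls₀ (rep c) ∖ S` — either `v ∈ fT.T`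
and the factor at `v` of (A).1 vanishes by (C), or `v ∉ S ∪ fT.T` and (A).2 applies. [cite: FlathCorvallis1979, Thm. 3 and Thm. 4] [cite: Rogawski1990, §13.7 p. 206; §14.5 p. 237; §14.6 p. 236] -/
theorem traceFactorisation_of_four
    (hA : IsProductHaar L H ν νinf μv →
      ∃ S₀ : Finset (Places L), ∀ S : Finset (Places L), S₀ ⊆ S →
        ∀ (c : Cls (Gp L H) μ) (fS : TestS₀ L H ι T hT S) (fT : Unr₀ L H S), cptTriv₀ L ι H T hT μ c →
          (ramCls₀ (rep (Gp L H) μ c) ⊆ ↑S ∪ ↑fT.T →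
            trGp₀ (Gp L H) μ ν c (tens₀ S fS fT) =
              UnitaryGroup.archTr₀ L ι H T hT νinf (clInfChoiceU L H ι T hT μ (archDegOneClass 1 (Or.inl rfl)) (rep (Gp L H) μ c)) fS.arch *
                (∏ v : ↥S, (letI : MeasurableSpace ((cmDatum L 3 H).Local v.1) := borel _; (clFinChoice (rep (Gp L H) μ c) v.1).smoothTrace (μv v.1) (fS.loc v))) *
                ∏ v ∈ fT.T, (letI : MeasurableSpace ((cmDatum L 3 H).Local v) := borel _; (clFinChoice (rep (Gp L H) μ c) v).smoothTrace (μv v) (fT.loc v))) ∧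
          (¬ ramCls₀ (rep (Gp L H) μ c) ⊆ ↑S ∪ ↑fT.T → trGp₀ (Gp L H) μ ν c (tens₀ S fS fT) = 0))
    (hB : (∀ v : Places L, μv v (cmLocalIntegralLevel L 3 H v : Set ((cmDatum L 3 H).Local v)) = 1) →
      ∀ (S : Finset (Places L)) (c : Cls (Gp L H) μ) (fT : Unr₀ L H S),
        hat₀ L H S (germ L H S fun v => evpChoice (rep (Gp L H) μ c) v (μv v)) fT =
          ∏ v ∈ fT.T, (letI : MeasurableSpace ((cmDatum L 3 H).Local v) := borel _; (clFinChoice (rep (Gp L H) μ c) v).smoothTrace (μv v) (fT.loc v)))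
    (hC : ∃ S₀ : Finset (Places L), ∀ v : Places L, v ∉ S₀ →
      ∀ P : DiscreteAutomorphicRep (Gp L H) μ, v ∈ ramCls₀ P →
        ∀ (μ_v : @Measure ((cmDatum L 3 H).Local v) (borel _)),
          (letI : MeasurableSpace ((cmDatum L 3 H).Local v) := borel _; μ_v.IsHaarMeasure) →
          ∀ f : (cmDatum L 3 H).Local v → ℂ, HasCompactSupport f → IsLevel (cmLocalIntegralLevel L 3 H v) f →
            (letI : MeasurableSpace ((cmDatum L 3 H).Local v) := borel _; (clFinChoice P v).smoothTrace μ_v f) = 0)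
    (hD : ν.IsMulLeftInvariant →
      ∀ (S : Finset (Places L)) (c : Cls (Gp L H) μ) (fS : TestS₀ L H ι T hT S) (fT : Unr₀ L H S),
        ¬ cptTriv₀ L ι H T hT μ c → trGp₀ (Gp L H) μ ν c (tens₀ S fS fT) = 0) :
    TraceFactorisation L H ι T hT μ ν νinf μv := by
  classical
  intro hPH
  obtain ⟨S₀A, hA'⟩ := hA hPH
  obtain ⟨S₀C, hC'⟩ := hC
  have hvol : ∀ v : Places L, μv v (cmLocalIntegralLevel L 3 H v : Set ((cmDatum L 3 H).Local v)) = 1 :=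
    fun v => hPH.apply_cmLocalIntegralLevel v
  haveI : ν.IsHaarMeasure := hPH.isHaarMeasure
  refine ⟨S₀A ∪ S₀C, fun S hS c fS fT => ?_⟩
  have hSA : S₀A ⊆ S := Finset.union_subset_left hS
  have hSC : S₀C ⊆ S := Finset.union_subset_right hS
  refine ⟨fun hAdm => ?_, fun hnot => ?_⟩
  · -- main branch: (A).1 + `chS₀_def` + (B)
    obtain ⟨hram, hcpt⟩ := hAdm
    have hram' : ramCls₀ (rep (Gp L H) μ c) ⊆ ↑S ∪ ↑fT.T := hram.trans Set.subset_union_left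
    rw [((hA' S hSA c fS fT hcpt).1 hram'), chS₀_def, hB hvol S c fT]
  · -- zero branch
    by_cases hcpt : cptTriv₀ L ι H T hT μ c
    · have hram : ¬ ramCls₀ (rep (Gp L H) μ c) ⊆ ↑S := fun h => hnot ⟨h, hcpt⟩
      by_cases hST : ramCls₀ (rep (Gp L H) μ c) ⊆ ↑S ∪ ↑fT.T
      · obtain ⟨v, hv, hvS⟩ := Set.not_subset.1 hram
        have hvT : v ∈ fT.T := by
          rcases hST hv with h | h
          · exact absurd h hvS
          · exact h
        have hvC : v ∉ S₀C := fun h => hvS (hSC h)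
        have hzero : (letI : MeasurableSpace ((cmDatum L 3 H).Local v) := borel _;
            (clFinChoice (rep (Gp L H) μ c) v).smoothTrace (μv v) (fT.loc v)) = 0 :=
          hC' v hvC (rep (Gp L H) μ c) hv (μv v) (hPH.isHaarMeasure_local v) (fT.loc v) (fT.hcs v) (fT.hlev v)
        rw [(hA' S hSA c fS fT hcpt).1 hST, Finset.prod_eq_zero hvT hzero, mul_zero]
      · exact (hA' S hSA c fS fT hcpt).2 hST
    · exact hD inferInstance S c fS fT hcpt

/-- **TF FROM THE LETTER «ArchFinTraceSplit» AT A FRAME** — `traceFactorisation_of_four` fed with ★ J1b `F0P3TracePureTensorOfArchSplit.stub_trace_pureTensor_of_archFinTraceSplit`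
at `hA` and the ★ heads (B) `stub_sphericalLine_eigen_closed`, (C) `smoothTrace_clFinChoice_eq_zero_offS0`, (D) `trGp₀_tens₀_eq_zero_of_not_cptTriv₀` at `hB hC hD`
(= the TF line's `traceFactorisation_holds` with its one open stub replaced by the letter). [cite: FlathCorvallis1979, Thm. 3 and Thm. 4] [cite: Rogawski1990, §13.7 p. 206; §14.5 p. 237]
[cite: BorelJacquet1979, §4.1 and §4.6] [cite: Knapp1986, Thm. 10.2] -/
theorem traceFactorisation_of_archFinTraceSplit (hAFS : ArchFinTraceSplit L H ι T hT μ ν νinf μv) :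
    TraceFactorisation L H ι T hT μ ν νinf μv :=
  traceFactorisation_of_four L H ι T hT μ ν νinf μv
    (F0P3TracePureTensorOfArchSplit.stub_trace_pureTensor_of_archFinTraceSplit L H ι T hT μ ν νinf μv hAFS)
    (F0P3TraceFactorisationSphericalLine.stub_sphericalLine_eigen_closed L H μ μv)
    (F0P3TraceFactorisationZeroBranch.smoothTrace_clFinChoice_eq_zero_offS0 L H ι T hT μ)
    (F0P3TraceFactorisationKcIdempotent.trGp₀_tens₀_eq_zero_of_not_cptTriv₀ L H ι T hT μ ν)

end Frame

/-- **THE CLOSED FORM FOR THE CLOSER'S REGISTRY: `StubTF` FROM THE ∀-CLOSED LETTER «ArchFinTraceSplit»** — hypothesis and conclusion carry EXACTLY the binder list of K9β's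
`StubTF` (§C.6 of `Cruxes/H413/Lines/F0_U3LettersRung1.lean`) = the TF line's `TraceFactorisationClosed` ((V47) telescope); the ∀-closure of the letter is INLINED (no `def`).
The closer's junction: `theorem stub_TF : StubTF := F0P3TraceFactorisationOfStubs.stubTF_of_archFinTraceSplit stub_AFS` with the registered print stub
`stub_AFS : ‹this hypothesis, token for token›` (#84 re-denominated to the archimedean ∕ Hilbert half, ROAD «TF» lead memo §2). [cite: FlathCorvallis1979, Thm. 3 and Thm. 4]
[cite: Rogawski1990, §13.7 p. 206; §14.5 p. 237] [cite: CartierCorvallis1979, §IV.1 Cor. 4.1] -/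
theorem stubTF_of_archFinTraceSplit
    (hAFS : ∀ (L : Type) [Field L] [NumberField L] [IsCMField L] (H : Matrix (Fin 3) (Fin 3) L) (ι : L →+* ℂ) (T : GL (Fin 3) ℂ)
      (hT : (T : Matrix (Fin 3) (Fin 3) ℂ)ᴴ * H.map ι * (T : Matrix (Fin 3) (Fin 3) ℂ) = Literature.Geometry.ComplexHyperbolic.BallModel.J)
      (μ : Measure (F0P3InnerFormClassificationV6.Gp L H).automorphicQuotient) [(F0P3InnerFormClassificationV6.Gp L H).IsAutomorphicMeasure μ]
      [MeasurableSpace (F0P3InnerFormClassificationV6.Gp L H).Adelic] [BorelSpace (F0P3InnerFormClassificationV6.Gp L H).Adelic]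
      (ν : Measure (F0P3InnerFormClassificationV6.Gp L H).Adelic) [IsFiniteMeasureOnCompacts ν]
      (νinf : @Measure (UnitaryGroup.arch (↥(maximalRealSubfield L)) L (IsCMField.complexConj L) 3 H) (borel _))
      (μv : ∀ v : HeightOneSpectrum (𝓞 ↥(maximalRealSubfield L)), @Measure ((cmDatum L 3 H).Local v) (borel _)),
      F0P3LettersArchFinTraceSplit.ArchFinTraceSplit L H ι T hT μ ν νinf μv) :
    ∀ (L : Type) [Field L] [NumberField L] [IsCMField L] (H : Matrix (Fin 3) (Fin 3) L) (ι : L →+* ℂ) (T : GL (Fin 3) ℂ)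
      (hT : (T : Matrix (Fin 3) (Fin 3) ℂ)ᴴ * H.map ι * (T : Matrix (Fin 3) (Fin 3) ℂ) = Literature.Geometry.ComplexHyperbolic.BallModel.J)
      (μ : Measure (F0P3InnerFormClassificationV6.Gp L H).automorphicQuotient) [(F0P3InnerFormClassificationV6.Gp L H).IsAutomorphicMeasure μ]
      [MeasurableSpace (F0P3InnerFormClassificationV6.Gp L H).Adelic] [BorelSpace (F0P3InnerFormClassificationV6.Gp L H).Adelic]
      (ν : Measure (F0P3InnerFormClassificationV6.Gp L H).Adelic) [IsFiniteMeasureOnCompacts ν]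
      (νinf : @Measure (UnitaryGroup.arch (↥(maximalRealSubfield L)) L (IsCMField.complexConj L) 3 H) (borel _))
      (μv : ∀ v : HeightOneSpectrum (𝓞 ↥(maximalRealSubfield L)), @Measure ((cmDatum L 3 H).Local v) (borel _)),
      F0P3LettersTraceFactorisationS0.TraceFactorisation L H ι T hT μ ν νinf μv :=
  fun L _ _ _ H ι T hT μ _ _ _ ν _ νinf μv => traceFactorisation_of_archFinTraceSplit L H ι T hT μ ν νinf μv (hAFS L H ι T hT μ ν νinf μv)

end Summit.HodgeConjecture.HodgeConjecture.Cruxes.H413.F0P3TraceFactorisationOfStubs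

end
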